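import Summits.QuantumFields.BalabanUV.Beta.GAN24.Lin4LegTower
import Summits.QuantumFields.BalabanUV.Beta.GAN24.Push4
import Summits.QuantumFields.BalabanUV.Beta.GAN24.ThreeLegDoubleFreezeSummable

/-!
# `BalabanUV.Beta.GAN24.LegStepPush` — binder row G-an2-4 ∕ (CONV-C), W-slot, the (α-0) parity re-cut, located crux (Q-L-k₀) (RULING R-gan24p1-g36-1:
# the mechanism of record = leaf-01 g74's double first-moment freezing): **THE CARRIER — leaf-03's one-step leg map `legStep` IS A THREE-LEG PUSH**
# `legStep kc G K N W = kc • legPush (krow K N) (colH G N) W` (kernel leg = the FULL multiplier row of `K`, slot legs = the `ℋ`-columns of `G`, bond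
# symmetrisation built in, position index free), and **THE ONE-PUSH `LocStencil₂` BOUND** for abstract legs at blocking `L` acting on a block-summed table
# `bsum L ∘ W`: the scalar core `ThreeLegDoubleFreeze.abs_threeLeg_blockSum_le` per fibre triple, the finite fibre sums pulled outside by
# `ThreeLegDoubleFreezeSummable`'s summabilities, the symmetrised twin at one third of the rate, packaged by `locStencil₂_of_env_bound`.

NOT IN PRINT; OUR BOOKKEEPING + PROOF ([folklore]; two plumbing `def`s (`krow`, `legPush`) asserting nothing; 0 cited facts, 0 `def … : Prop`, 0 sorry,
0 wall binders).  HONEST FRAMING (cell contract, verbatim): «discharging `BetaPertH` makes Bałaban's UV stability UNCONDITIONAL — a real constructive-QFT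
result; it is NOT the continuum limit and NOT the Clay problem.»  HONEST DEPENDENCY (verbatim): «continuum YM on T⁴ ⇐ BetaPertH ∧ nine spine estimates
(0/9 proved); BetaPertH ⇐ (D1) ∧ (D4) ∧ CAP+tail; G-an2-4 gates asym, D1 and NE2/3/4.»

## What is proved (generic `d`)
* §1 `krow K N α x′ f x := K (N•x′) x (inr α) f` (the multiplier row of `K` read at the coarse multiplier point, ALL column fibres `f` — leaf-17's `rowM` is its
  `f = inl κ` part); `legPush l r X` (the three-leg push: `Σ'_x Σ_f l α x′ f x · ½(vertex2W r X s + vertex2W r X sᵀ) x p f b` on field rows, `0` on multiplier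
  rows); **`legStep_eq_smul_legPush`** — `legStep kc G K N W = kc • legPush (krow K N) (colH G N) W` (definitional: `legStep_inl`, `comp`, `vsym`,
  `vertex2OfK_eq_vertex2W`); `legPush_inl ∕ _inr`, `vertex2W_entry` (the double vertex read entrywise: `Σ_{κ₁} Σ'_v r μ y κ₁ v · Σ_{κ₂} Σ'_{v′} r ν y′ κ₂ v′ · X …`).
* §2 **`abs_legPush_bsum_inl_le`** ∕ **`locStencil₂_legPush_bsum`** — for slot legs `r` with leaf-12-type envelopes at blocking `L` (sup `a·E`, unit gradient
  `a′·E`, `E_y(v) = e^{−κ₀‖quo L v − y‖∞}`), a kernel leg `l` with sup envelope `a_ρ·E_{x′}`, a table `W` with `LocStencil₂ W C δ` and the two slot-charge rows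
  + the double-charge row bounded by `g` (per fibre), rates `0 < δ`, `0 < κ₀ ≤ (δ/6)·L`:
  `LocStencil₂ (legPush l r (bsum L ∘ W)) (|Fib d|·(d+1)²·a_ρ·Jc·L^{d+1}·Zl(κ₀/(2(d+1)))) (κ₀/(18(d+1)))`, `Jc` = PART 2's displayed constant — the bond
  symmetrisation costs the factor `3` in the rate (the swapped term's legs are centred at the other slot).  With leaf-03 g60's `transport_legStepB_eq` (the
  k₀-fold chain = the pure chain on `bsumPow`) the k₀ = 1 window is this theorem at `l = krow K♮ᴱ Lc`, `r = colH K♮ᴱ Lc`; the k₀-fold window needs the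
  NESTING `legPush l₁ r₁ ∘ legPush l₂ r₂ = legPush (l₂ ⋆ l₁) (legComp r₂ r₁)` on bounded tables (the `Push4Nest` ∕ `Push3Nest` pattern) — the next file.
Asserts NOTHING about Bałaban's tables; NOT (H1♮) (nesting, the dressed legs via the OWNER g36's block-ℓ¹ twin `ThreeLegDoubleFreezeBlockL1` +
`DressedLegSawtoothBlockL1`, the slot charges via `SlotChargeMoment`, and the socket instantiation are other files); discharges NOTHING of (Q-L) ∕ (C) ∕
«T2Shape» ∕ «T2Drift» ∕ (hW, hWall); NEVER «G-an2-4 closed» as (CONV-C); NOT D1, NOT `BetaPertH`, NOT continuum, NOT Clay; not in print.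
Unit `b2b-balaban-gan24-formalise-leaf-01` (G-an2-4 formalisation swarm, leaf prover 01, gen 74), 2026-08-23.
-/

noncomputable section

open Finset
open scoped BigOperators
open Literature.MathematicalPhysics.QuantumFieldTheory.LatticeForm (quo)
open Literature.MathematicalPhysics.QuantumFieldTheory.Balaban1983to89
open Literature.MathematicalPhysics.QuantumFieldTheory.Balaban1983to89.Beta
open B4ContourShift (supNorm abs_le_supNorm supNorm_nonneg)
open B4Reflection242 (supNorm_le_of_forall supNorm_add_le)
open B12Sec2to5 (l1 l1_nonneg)
open ExpKernelCalculus (MKer comp Zl Zl_nonneg Zl_pos)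
open OneStepResolventKernel (Fib)
open OneStepKernelFamily (colH)
open AffineAveraging (box toSite)
open BalabanCompositeJets (LocStencil₂ LocStencil₂.nonneg)
open Summit.QuantumFields.BalabanUV.Beta.GAN24.BiStencilZeroMode (Tab)
open Summit.QuantumFields.BalabanUV.Beta.GAN24.Push4 (vertexW vertexW_apply vertex2W vertex2OfK_eq_vertex2W)
open Summit.QuantumFields.BalabanUV.Beta.GAN24.T2RecursionAffine (vsym)
open Summit.QuantumFields.BalabanUV.Beta.GAN24.Lin4LegTower (legStep legStep_inl legStep_inr bsum bsum_apply)
open Summit.QuantumFields.BalabanUV.Beta.GAN24.EnvelopeBlockSum (env_le_one tsum_env4_le)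
open Summit.QuantumFields.BalabanUV.Beta.GAN24.ThreeLegDoubleFreeze (abs_threeLeg_blockSum_le)
open Summit.QuantumFields.BalabanUV.Beta.GAN24.ThreeLegDoubleFreezeSummable (summable_slotLayer summable_kernelLayer locStencil₂_of_env_bound)

namespace Summit.QuantumFields.BalabanUV.Beta.GAN24.LegStepPush

variable {d : ℕ}

/-! ## §1 The carrier -/

/-- [folklore] Plumbing `def`: **THE FULL MULTIPLIER ROW OF `K` AT THE COARSE MULTIPLIER POINT**, `krow K N α x′ f x := K (N•x′) x (inr α) f` — all column fibres
`f` (leaf-17's `Push4.rowM K N α x′ κ x` is the field part `f = inl κ`).  A definition asserting nothing. -/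
def krow (K : MKer (d + 1) (Fib d)) (N : ℕ) (α : Fin (d + 1)) (x' : Fin (d + 1) → ℤ) (f : Fib d) (x : Fin (d + 1) → ℤ) : ℝ :=
  K ((N : ℤ) • x') x (Sum.inr α) f

/-- [folklore] Plumbing `def`: **THE THREE-LEG PUSH WITH FREE POSITION** — the two SLOTS of the table through the leg family `r` (bond-symmetrised double
vertex, leaf-17's `Push4.vertex2W`), the table's LEFT kernel leg through `l` (all row fibres), the right kernel index (the position) untouched; field rows
only: `legPush l r X κ u κ′ u′ x′ p (inl α) b := Σ'_x Σ_f l α x′ f x · ½·(vertex2W r X κ u κ′ u′ + vertex2W r X κ′ u′ κ u) x p f b`. -/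
def legPush (l : Fin (d + 1) → (Fin (d + 1) → ℤ) → Fib d → (Fin (d + 1) → ℤ) → ℝ)
    (r : Fin (d + 1) → (Fin (d + 1) → ℤ) → Fin (d + 1) → (Fin (d + 1) → ℤ) → ℝ) (X : Tab d) : Tab d :=
  fun κ u κ' u' => fun x' p a b =>
    match a with
    | Sum.inl α => ∑' x, ∑ f, l α x' f x * ((1 / 2 : ℝ) * (vertex2W r X κ u κ' u' x p f b + vertex2W r X κ' u' κ u x p f b))
    | Sum.inr _ => 0

variable (l : Fin (d + 1) → (Fin (d + 1) → ℤ) → Fib d → (Fin (d + 1) → ℤ) → ℝ)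
  (r : Fin (d + 1) → (Fin (d + 1) → ℤ) → Fin (d + 1) → (Fin (d + 1) → ℤ) → ℝ) (X : Tab d)

/-- [folklore] `legPush`: field rows. -/
theorem legPush_inl (κ : Fin (d + 1)) (u : Fin (d + 1) → ℤ) (κ' : Fin (d + 1)) (u' : Fin (d + 1) → ℤ) (x' p : Fin (d + 1) → ℤ)
    (α : Fin (d + 1)) (b : Fib d) :
    legPush l r X κ u κ' u' x' p (Sum.inl α) b
      = ∑' x, ∑ f, l α x' f x * ((1 / 2 : ℝ) * (vertex2W r X κ u κ' u' x p f b + vertex2W r X κ' u' κ u x p f b)) := rfl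

/-- [folklore] `legPush`: no multiplier rows. -/
theorem legPush_inr (κ : Fin (d + 1)) (u : Fin (d + 1) → ℤ) (κ' : Fin (d + 1)) (u' : Fin (d + 1) → ℤ) (x' p : Fin (d + 1) → ℤ)
    (ν : Fin (d + 1)) (b : Fib d) : legPush l r X κ u κ' u' x' p (Sum.inr ν) b = 0 := rfl

/-- [folklore] The double vertex read entrywise: `vertex2W r X μ y ν y′ x p f b = Σ_{κ₁} Σ'_v r μ y κ₁ v · Σ_{κ₂} Σ'_{v′} r ν y′ κ₂ v′ · X κ₁ v κ₂ v′ x p f b`. -/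
theorem vertex2W_entry (μ : Fin (d + 1)) (y : Fin (d + 1) → ℤ) (ν : Fin (d + 1)) (y' : Fin (d + 1) → ℤ) (x p : Fin (d + 1) → ℤ) (f b : Fib d) :
    vertex2W r X μ y ν y' x p f b = ∑ κ₁, ∑' v, r μ y κ₁ v * ∑ κ₂, ∑' v', r ν y' κ₂ v' * X κ₁ v κ₂ v' x p f b := by
  simp only [vertex2W, vertexW_apply]

/-- [folklore] **leaf-03's ONE-STEP LEG MAP IS A THREE-LEG PUSH**: `legStep kc G K N W = kc • legPush (krow K N) (colH G N) W` — the kernel leg is the full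
multiplier row of `K`, the slot legs are the `ℋ`-columns of `G` (an2's `vertex2OfK G N = vertex2W (colH G N)`), the symmetrisation is leaf-04's `vsym`.
Definitional (no summability). -/
theorem legStep_eq_smul_legPush (kc : ℝ) (G K : MKer (d + 1) (Fib d)) (N : ℕ) (W : Tab d) :
    legStep kc G K N W = kc • legPush (krow K N) (colH G N) W := by
  funext κ u κ' u' x' p a b
  rcases a with α | ν
  · rw [legStep_inl]
    show kc * comp K (vsym G N W κ u κ' u') ((N : ℤ) • x') p (Sum.inr α) b = kc * legPush (krow K N) (colH G N) W κ u κ' u' x' p (Sum.inl α) b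
    rw [legPush_inl]
    simp only [comp, krow, vsym, vertex2OfK_eq_vertex2W, Pi.smul_apply, Pi.add_apply, smul_eq_mul]
  · rw [legStep_inr]
    show (0 : ℝ) = kc * legPush (krow K N) (colH G N) W κ u κ' u' x' p (Sum.inr ν) b
    rw [legPush_inr, mul_zero]

/-- [folklore] `‖u′ − u‖∞ = ‖u − u′‖∞`. -/
theorem supNorm_sub_comm (u u' : Fin (d + 1) → ℤ) : supNorm (u' - u) = supNorm (u - u') := by
  simp only [supNorm, Pi.sub_apply, abs_sub_comm]

/-! ## §2 The one-push bound: abstract legs at blocking `L` on a block-summed table -/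

section OnePush

variable {L : ℕ} {κ₀ δ a a' aρ C g : ℝ}
  {l : Fin (d + 1) → (Fin (d + 1) → ℤ) → Fib d → (Fin (d + 1) → ℤ) → ℝ}
  {r : Fin (d + 1) → (Fin (d + 1) → ℤ) → Fin (d + 1) → (Fin (d + 1) → ℤ) → ℝ} {W : Tab d}
  (hL : 1 ≤ L) (hκ : 0 < κ₀) (hδ : 0 < δ) (hgap : κ₀ ≤ δ / 6 * L)
  (ha : 0 ≤ a) (ha' : 0 ≤ a') (haρ : 0 ≤ aρ) (hg : 0 ≤ g)
  (hr : ∀ μ y κ v, |r μ y κ v| ≤ a * Real.exp (-(κ₀ * supNorm (quo L v - y))))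
  (hr' : ∀ μ y κ v i, |r μ y κ (v + Pi.single i 1) - r μ y κ v| ≤ a' * Real.exp (-(κ₀ * supNorm (quo L v - y))))
  (hl : ∀ α x' f x, |l α x' f x| ≤ aρ * Real.exp (-(κ₀ * supNorm (quo L x - x'))))
  (hW : LocStencil₂ W C δ)
  (hq₂ : ∀ κ₁ v κ₂ x p f b, |∑' v', W κ₁ v κ₂ v' x p f b| ≤ g * Real.exp (-δ * (l1 (x - v) + l1 (p - v))))
  (hq₁ : ∀ κ₁ κ₂ v' x p f b, |∑' v, W κ₁ v κ₂ v' x p f b| ≤ g * Real.exp (-δ * (l1 (x - v') + l1 (p - v'))))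
  (hq₁₂ : ∀ κ₁ κ₂ x p f b, |∑' v, ∑' v', W κ₁ v κ₂ v' x p f b| ≤ g * Real.exp (-δ * l1 (p - x)))

include hL hκ hδ hgap ha ha' hg hr hr' hW hq₂ in
/-- [folklore] The double vertex of the block-summed table, read entrywise with BOTH fibre sums outside:
`vertex2W r (bsum L ∘ W) μ y ν y′ x p f b = Σ_{κ₁} Σ_{κ₂} Σ'_v r μ y κ₁ v · Σ'_{v′} r ν y′ κ₂ v′ · Σ_t W κ₁ v κ₂ v′ x (L•p + t) f b`
(`ThreeLegDoubleFreezeSummable.summable_slotLayer` moves `Σ_{κ₂}` through `Σ'_v`). -/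
theorem vertex2W_bsum_entry (μ : Fin (d + 1)) (y : Fin (d + 1) → ℤ) (ν : Fin (d + 1)) (y' : Fin (d + 1) → ℤ) (x p : Fin (d + 1) → ℤ) (f b : Fib d) :
    vertex2W r (fun κ₁ v κ₂ v' => bsum L (W κ₁ v κ₂ v')) μ y ν y' x p f b
      = ∑ κ₁, ∑ κ₂, ∑' v, r μ y κ₁ v * ∑' v', r ν y' κ₂ v' * ∑ t ∈ box (d + 1) L, W κ₁ v κ₂ v' x ((L : ℤ) • p + toSite t) f b := by
  have hC : 0 ≤ C := hW.nonneg
  rw [vertex2W_entry]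
  refine Finset.sum_congr rfl fun κ₁ _ => ?_
  simp only [bsum_apply]
  have hS : ∀ κ₂ ∈ (Finset.univ : Finset (Fin (d + 1))),
      Summable fun v => r μ y κ₁ v * ∑' v', r ν y' κ₂ v' * ∑ t ∈ box (d + 1) L, W κ₁ v κ₂ v' x ((L : ℤ) • p + toSite t) f b :=
    fun κ₂ _ => summable_slotLayer (h₁ := fun v => r μ y κ₁ v) (h₂ := fun v' => r ν y' κ₂ v') (W := fun v v' x q => W κ₁ v κ₂ v' x q f b)
      (c₁ := y) (c₂ := y') (c₄ := p) hL hκ hδ hgap ha ha' hC hg (fun v => hr μ y κ₁ v) (fun v' => hr ν y' κ₂ v') (fun v' i => hr' ν y' κ₂ v' i)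
      (fun v v' x q => hW κ₁ v κ₂ v' x q f b) (fun v x q => hq₂ κ₁ v κ₂ x q f b) x
  rw [← Summable.tsum_finsetSum hS]
  exact tsum_congr fun v => by rw [Finset.mul_sum]

include hL hκ hδ hgap ha ha' haρ hg hr hr' hl hW hq₂ hq₁ hq₁₂ in
/-- NOT IN PRINT; OUR PROOF.  **THE ONE-PUSH ENTRY BOUND** (field rows): `|legPush l r (bsum L ∘ W) κ u κ′ u′ x′ y (inl α) b| ≤ |Fib d|·(d+1)²·a_ρ·Jc·L^{d+1}·Zl(κ₀/(2(d+1)))·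
e^{−(κ₀/18)(‖u′−u‖∞+‖x′−u‖∞+‖y−u‖∞)}` — PART 2's core per fibre triple `(f, κ₁, κ₂)` and per symmetrisation summand (the swapped summand's legs are centred
at the other slot, whence the rate `κ₀/18 = (κ₀/6)/3`). -/
theorem abs_legPush_bsum_inl_le (κ : Fin (d + 1)) (u : Fin (d + 1) → ℤ) (κ' : Fin (d + 1)) (u' : Fin (d + 1) → ℤ) (x' y : Fin (d + 1) → ℤ)
    (α : Fin (d + 1)) (b : Fib d) :
    |legPush l r (fun κ₁ v κ₂ v' => bsum L (W κ₁ v κ₂ v')) κ u κ' u' x' y (Sum.inl α) b|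
      ≤ (Fintype.card (Fib d) : ℝ) * ((d : ℝ) + 1) ^ 2 *
        (aρ * ((Real.exp κ₀ * Zl (d + 1) (δ / 6)) *
          (a' ^ 2 * C * Real.exp κ₀ ^ 2 * (2 / (δ / 6) * Zl (d + 1) (δ / 6 / 2)) ^ 2
            + 2 * (a * a' * g * Real.exp κ₀ * (2 / (δ / 6) * Zl (d + 1) (δ / 6 / 2))) + a ^ 2 * g)) *
        ((L : ℝ) ^ (d + 1) * Zl (d + 1) (κ₀ / (2 * ((d : ℝ) + 1))))) *
        Real.exp (-(κ₀ / 18) * (supNorm (u' - u) + supNorm (x' - u) + supNorm (y - u))) := by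
  have hC : 0 ≤ C := hW.nonneg
  have hZ := Zl_nonneg (D := d + 1) (show 0 < δ / 6 by positivity)
  have hZ' := Zl_nonneg (D := d + 1) (show 0 < δ / 6 / 2 by positivity)
  have hZκ := Zl_nonneg (D := d + 1) (show 0 < κ₀ / (2 * ((d : ℝ) + 1)) by positivity)
  set K : ℝ := aρ * ((Real.exp κ₀ * Zl (d + 1) (δ / 6)) *
      (a' ^ 2 * C * Real.exp κ₀ ^ 2 * (2 / (δ / 6) * Zl (d + 1) (δ / 6 / 2)) ^ 2
        + 2 * (a * a' * g * Real.exp κ₀ * (2 / (δ / 6) * Zl (d + 1) (δ / 6 / 2))) + a ^ 2 * g)) *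
      ((L : ℝ) ^ (d + 1) * Zl (d + 1) (κ₀ / (2 * ((d : ℝ) + 1)))) with hK
  have hK0 : 0 ≤ K := by rw [hK]; positivity
  set S : ℝ := supNorm (u' - u) + supNorm (x' - u) + supNorm (y - u) with hS
  -- the per-fibre kernel layers and their core bounds
  set J : Fib d → Fin (d + 1) → Fin (d + 1) → (Fin (d + 1) → ℤ) → (Fin (d + 1) → ℤ) → (Fin (d + 1) → ℤ) → ℝ :=
    fun f κ₁ κ₂ c c' x => ∑' v, r κ c κ₁ v * ∑' v', r κ' c' κ₂ v' * ∑ t ∈ box (d + 1) L, W κ₁ v κ₂ v' x ((L : ℤ) • y + toSite t) f b with hJ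
  -- ... but the swapped summand has the SLOT DIRECTIONS swapped too; treat both summands with their own direction labels:
  set J₁ : Fib d → Fin (d + 1) → Fin (d + 1) → (Fin (d + 1) → ℤ) → ℝ :=
    fun f κ₁ κ₂ x => ∑' v, r κ u κ₁ v * ∑' v', r κ' u' κ₂ v' * ∑ t ∈ box (d + 1) L, W κ₁ v κ₂ v' x ((L : ℤ) • y + toSite t) f b with hJ₁
  set J₂ : Fib d → Fin (d + 1) → Fin (d + 1) → (Fin (d + 1) → ℤ) → ℝ :=
    fun f κ₁ κ₂ x => ∑' v, r κ' u' κ₁ v * ∑' v', r κ u κ₂ v' * ∑ t ∈ box (d + 1) L, W κ₁ v κ₂ v' x ((L : ℤ) • y + toSite t) f b with hJ₂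
  have core₁ : ∀ f κ₁ κ₂, (Summable fun x => l α x' f x * J₁ f κ₁ κ₂ x) ∧
      |∑' x, l α x' f x * J₁ f κ₁ κ₂ x| ≤ K * Real.exp (-(κ₀ / 6) * (supNorm (u' - u) + supNorm (x' - u) + supNorm (y - u))) := by
    intro f κ₁ κ₂
    refine ⟨summable_kernelLayer (h₁ := fun v => r κ u κ₁ v) (h₂ := fun v' => r κ' u' κ₂ v') (ρ := fun x => l α x' f x)
        (W := fun v v' x q => W κ₁ v κ₂ v' x q f b) (c₁ := u) (c₂ := u') (c₃ := x') (c₄ := y)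
        hL hκ hδ hgap ha ha' haρ hC hg (fun v => hr κ u κ₁ v) (fun v i => hr' κ u κ₁ v i) (fun v' => hr κ' u' κ₂ v') (fun v' i => hr' κ' u' κ₂ v' i)
        (fun x => hl α x' f x) (fun v v' x q => hW κ₁ v κ₂ v' x q f b) (fun v x q => hq₂ κ₁ v κ₂ x q f b) (fun v' x q => hq₁ κ₁ κ₂ v' x q f b)
        (fun x q => hq₁₂ κ₁ κ₂ x q f b), ?_⟩
    have h := abs_threeLeg_blockSum_le (h₁ := fun v => r κ u κ₁ v) (h₂ := fun v' => r κ' u' κ₂ v') (ρ := fun x => l α x' f x)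
        (W := fun v v' x q => W κ₁ v κ₂ v' x q f b) (c₁ := u) (c₂ := u') (c₃ := x') (c₄ := y)
        hL hκ hδ hgap ha ha' haρ hC hg (fun v => hr κ u κ₁ v) (fun v i => hr' κ u κ₁ v i) (fun v' => hr κ' u' κ₂ v') (fun v' i => hr' κ' u' κ₂ v' i)
        (fun x => hl α x' f x) (fun v v' x q => hW κ₁ v κ₂ v' x q f b) (fun v x q => hq₂ κ₁ v κ₂ x q f b) (fun v' x q => hq₁ κ₁ κ₂ v' x q f b)
        (fun x q => hq₁₂ κ₁ κ₂ x q f b)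
    rw [hK]; exact h.trans (le_of_eq (by ring))
  have core₂ : ∀ f κ₁ κ₂, (Summable fun x => l α x' f x * J₂ f κ₁ κ₂ x) ∧
      |∑' x, l α x' f x * J₂ f κ₁ κ₂ x| ≤ K * Real.exp (-(κ₀ / 6) * (supNorm (u - u') + supNorm (x' - u') + supNorm (y - u'))) := by
    intro f κ₁ κ₂
    refine ⟨summable_kernelLayer (h₁ := fun v => r κ' u' κ₁ v) (h₂ := fun v' => r κ u κ₂ v') (ρ := fun x => l α x' f x)
        (W := fun v v' x q => W κ₁ v κ₂ v' x q f b) (c₁ := u') (c₂ := u) (c₃ := x') (c₄ := y)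
        hL hκ hδ hgap ha ha' haρ hC hg (fun v => hr κ' u' κ₁ v) (fun v i => hr' κ' u' κ₁ v i) (fun v' => hr κ u κ₂ v') (fun v' i => hr' κ u κ₂ v' i)
        (fun x => hl α x' f x) (fun v v' x q => hW κ₁ v κ₂ v' x q f b) (fun v x q => hq₂ κ₁ v κ₂ x q f b) (fun v' x q => hq₁ κ₁ κ₂ v' x q f b)
        (fun x q => hq₁₂ κ₁ κ₂ x q f b), ?_⟩
    have h := abs_threeLeg_blockSum_le (h₁ := fun v => r κ' u' κ₁ v) (h₂ := fun v' => r κ u κ₂ v') (ρ := fun x => l α x' f x)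
        (W := fun v v' x q => W κ₁ v κ₂ v' x q f b) (c₁ := u') (c₂ := u) (c₃ := x') (c₄ := y)
        hL hκ hδ hgap ha ha' haρ hC hg (fun v => hr κ' u' κ₁ v) (fun v i => hr' κ' u' κ₁ v i) (fun v' => hr κ u κ₂ v') (fun v' i => hr' κ u κ₂ v' i)
        (fun x => hl α x' f x) (fun v v' x q => hW κ₁ v κ₂ v' x q f b) (fun v x q => hq₂ κ₁ v κ₂ x q f b) (fun v' x q => hq₁ κ₁ κ₂ v' x q f b)
        (fun x q => hq₁₂ κ₁ κ₂ x q f b)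
    rw [hK]; exact h.trans (le_of_eq (by ring))
  -- the two decays against the symmetric rate `κ₀/18`
  have hdec₁ : Real.exp (-(κ₀ / 6) * (supNorm (u' - u) + supNorm (x' - u) + supNorm (y - u))) ≤ Real.exp (-(κ₀ / 18) * S) := by
    rw [Real.exp_le_exp, hS]
    have := supNorm_nonneg (u' - u); have := supNorm_nonneg (x' - u); have := supNorm_nonneg (y - u)
    nlinarith
  have hdec₂ : Real.exp (-(κ₀ / 6) * (supNorm (u - u') + supNorm (x' - u') + supNorm (y - u'))) ≤ Real.exp (-(κ₀ / 18) * S) := by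
    rw [Real.exp_le_exp, hS]
    have h1 := supNorm_add_le (x' - u') (u' - u)
    have h2 := supNorm_add_le (y - u') (u' - u)
    rw [show x' - u' + (u' - u) = x' - u by abel] at h1
    rw [show y - u' + (u' - u) = y - u by abel] at h2
    have h3 := supNorm_sub_comm u u'
    have := supNorm_nonneg (u - u'); have := supNorm_nonneg (x' - u'); have := supNorm_nonneg (y - u')
    nlinarith
  -- the entry as a finite sum of per-fibre kernel layers
  have eV : ∀ x f, (1 / 2 : ℝ) * (vertex2W r (fun κ₁ v κ₂ v' => bsum L (W κ₁ v κ₂ v')) κ u κ' u' x y f b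
      + vertex2W r (fun κ₁ v κ₂ v' => bsum L (W κ₁ v κ₂ v')) κ' u' κ u x y f b)
      = ∑ κ₁, ∑ κ₂, (1 / 2 : ℝ) * (J₁ f κ₁ κ₂ x + J₂ f κ₁ κ₂ x) := by
    intro x f
    rw [vertex2W_bsum_entry hL hκ hδ hgap ha ha' hg hr hr' hW hq₂, vertex2W_bsum_entry hL hκ hδ hgap ha ha' hg hr hr' hW hq₂]
    rw [hJ₁, hJ₂]
    simp only [← Finset.sum_add_distrib, Finset.mul_sum]
  have eE : legPush l r (fun κ₁ v κ₂ v' => bsum L (W κ₁ v κ₂ v')) κ u κ' u' x' y (Sum.inl α) b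
      = ∑ f, ∑ κ₁, ∑ κ₂, ∑' x, (1 / 2 : ℝ) * (l α x' f x * J₁ f κ₁ κ₂ x + l α x' f x * J₂ f κ₁ κ₂ x) := by
    rw [legPush_inl]
    have e1 : ∀ x, ∑ f, l α x' f x * ((1 / 2 : ℝ) * (vertex2W r (fun κ₁ v κ₂ v' => bsum L (W κ₁ v κ₂ v')) κ u κ' u' x y f b
        + vertex2W r (fun κ₁ v κ₂ v' => bsum L (W κ₁ v κ₂ v')) κ' u' κ u x y f b))
        = ∑ f, ∑ κ₁, ∑ κ₂, (1 / 2 : ℝ) * (l α x' f x * J₁ f κ₁ κ₂ x + l α x' f x * J₂ f κ₁ κ₂ x) := by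
      intro x
      refine Finset.sum_congr rfl fun f _ => ?_
      rw [eV x f, Finset.mul_sum]
      refine Finset.sum_congr rfl fun κ₁ _ => ?_
      rw [Finset.mul_sum]
      refine Finset.sum_congr rfl fun κ₂ _ => ?_
      ring
    simp_rw [e1]
    have hSx : ∀ f κ₁ κ₂, Summable fun x => (1 / 2 : ℝ) * (l α x' f x * J₁ f κ₁ κ₂ x + l α x' f x * J₂ f κ₁ κ₂ x) :=
      fun f κ₁ κ₂ => ((core₁ f κ₁ κ₂).1.add (core₂ f κ₁ κ₂).1).mul_left _
    rw [Summable.tsum_finsetSum (fun f _ => summable_sum fun κ₁ _ => summable_sum fun κ₂ _ => hSx f κ₁ κ₂)]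
    refine Finset.sum_congr rfl fun f _ => ?_
    rw [Summable.tsum_finsetSum (fun κ₁ _ => summable_sum fun κ₂ _ => hSx f κ₁ κ₂)]
    refine Finset.sum_congr rfl fun κ₁ _ => ?_
    exact Summable.tsum_finsetSum (fun κ₂ _ => hSx f κ₁ κ₂)
  rw [eE]
  -- per fibre triple: `½(|A| + |B|) ≤ K·e^{−(κ₀/18)S}`
  have hterm : ∀ f κ₁ κ₂, |∑' x, (1 / 2 : ℝ) * (l α x' f x * J₁ f κ₁ κ₂ x + l α x' f x * J₂ f κ₁ κ₂ x)| ≤ K * Real.exp (-(κ₀ / 18) * S) := by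
    intro f κ₁ κ₂
    rw [tsum_mul_left, (core₁ f κ₁ κ₂).1.tsum_add (core₂ f κ₁ κ₂).1, abs_mul, abs_of_pos (by norm_num : (0 : ℝ) < 1 / 2)]
    have h1 := (core₁ f κ₁ κ₂).2.trans (mul_le_mul_of_nonneg_left hdec₁ hK0)
    have h2 := (core₂ f κ₁ κ₂).2.trans (mul_le_mul_of_nonneg_left hdec₂ hK0)
    have h12 := (abs_add_le _ _).trans (add_le_add h1 h2)
    linarith
  calc |∑ f, ∑ κ₁, ∑ κ₂, ∑' x, (1 / 2 : ℝ) * (l α x' f x * J₁ f κ₁ κ₂ x + l α x' f x * J₂ f κ₁ κ₂ x)|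
      ≤ ∑ f, |∑ κ₁, ∑ κ₂, ∑' x, (1 / 2 : ℝ) * (l α x' f x * J₁ f κ₁ κ₂ x + l α x' f x * J₂ f κ₁ κ₂ x)| := Finset.abs_sum_le_sum_abs _ _
    _ ≤ ∑ f, ∑ κ₁, |∑ κ₂, ∑' x, (1 / 2 : ℝ) * (l α x' f x * J₁ f κ₁ κ₂ x + l α x' f x * J₂ f κ₁ κ₂ x)| :=
        Finset.sum_le_sum fun f _ => Finset.abs_sum_le_sum_abs _ _
    _ ≤ ∑ f, ∑ κ₁, ∑ κ₂, |∑' x, (1 / 2 : ℝ) * (l α x' f x * J₁ f κ₁ κ₂ x + l α x' f x * J₂ f κ₁ κ₂ x)| :=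
        Finset.sum_le_sum fun f _ => Finset.sum_le_sum fun κ₁ _ => Finset.abs_sum_le_sum_abs _ _
    _ ≤ ∑ _f : Fib d, ∑ _κ₁ : Fin (d + 1), ∑ _κ₂ : Fin (d + 1), K * Real.exp (-(κ₀ / 18) * S) :=
        Finset.sum_le_sum fun f _ => Finset.sum_le_sum fun κ₁ _ => Finset.sum_le_sum fun κ₂ _ => hterm f κ₁ κ₂
    _ = _ := by
        simp only [Finset.sum_const, Finset.card_univ, Fintype.card_fin, nsmul_eq_mul, hK, hS]
        push_cast; ring

include hL hκ hδ hgap ha ha' haρ hg hr hr' hl hW hq₂ hq₁ hq₁₂ in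
/-- NOT IN PRINT; OUR PROOF.  **THE ONE-PUSH `LocStencil₂` BOUND** — the three-leg push of a block-summed `LocStencil₂` table with bounded slot charges through
abstract legs at blocking `L` (slot legs: sup `a`, unit gradient `a′`; kernel leg: sup `a_ρ`; all with the block envelope `e^{−κ₀‖quo L · − centre‖∞}`):
`LocStencil₂ (legPush l r (bsum L ∘ W)) (|Fib d|·(d+1)²·a_ρ·Jc·L^{d+1}·Zl(κ₀/(2(d+1)))) (κ₀/(18(d+1)))`, `Jc = (e^{κ₀}Zl(δ/6))·(a′²·C·e^{2κ₀}·M² + 2·a·a′·g·e^{κ₀}·M + a²·g)`,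
`M = (2/(δ/6))·Zl(δ/12)`.  With `legStep_eq_smul_legPush` this is the k₀ = 1 window of (Q-L-k₀) up to `|kc|`; the k₀-fold window takes the composite legs
(the nesting file) and, for the DRESSED kernel leg, the OWNER g36's block-ℓ¹ twin of the core. -/
theorem locStencil₂_legPush_bsum :
    LocStencil₂ (legPush l r (fun κ₁ v κ₂ v' => bsum L (W κ₁ v κ₂ v')))
      ((Fintype.card (Fib d) : ℝ) * ((d : ℝ) + 1) ^ 2 *
        (aρ * ((Real.exp κ₀ * Zl (d + 1) (δ / 6)) *
          (a' ^ 2 * C * Real.exp κ₀ ^ 2 * (2 / (δ / 6) * Zl (d + 1) (δ / 6 / 2)) ^ 2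
            + 2 * (a * a' * g * Real.exp κ₀ * (2 / (δ / 6) * Zl (d + 1) (δ / 6 / 2))) + a ^ 2 * g)) *
        ((L : ℝ) ^ (d + 1) * Zl (d + 1) (κ₀ / (2 * ((d : ℝ) + 1))))))
      (κ₀ / 3 / (6 * ((d : ℝ) + 1))) := by
  have hC : 0 ≤ C := hW.nonneg
  have hZ := Zl_nonneg (D := d + 1) (show 0 < δ / 6 by positivity)
  have hZ' := Zl_nonneg (D := d + 1) (show 0 < δ / 6 / 2 by positivity)
  have hZκ := Zl_nonneg (D := d + 1) (show 0 < κ₀ / (2 * ((d : ℝ) + 1)) by positivity)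
  refine locStencil₂_of_env_bound (by positivity) (by positivity) fun κ u κ' u' x z a₀ b => ?_
  rw [show -(κ₀ / 3 / 6) = -(κ₀ / 18) by ring]
  rcases a₀ with α | ν
  · exact abs_legPush_bsum_inl_le hL hκ hδ hgap ha ha' haρ hg hr hr' hl hW hq₂ hq₁ hq₁₂ κ u κ' u' x z α b
  · rw [legPush_inr, abs_zero]; positivity

end OnePush

end Summit.QuantumFields.BalabanUV.Beta.GAN24.LegStepPush

end
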